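import Mathlib
import HarnessLib
import HarnessLib.Audit
import Summits.SmoothPoincare4.Statement
import Literature.Topology.FourManifolds.PropertyRStrict
import Literature.Topology.FourManifolds.HomotopyBallSlice
import Literature.Topology.FourManifolds.HomotopyBallSliceProofs
import HarnessLib.Audit.Check
import HarnessLib.Audit.Status.Attr

/-!
Route: VerlindeRLinks

DORMANT since 2026-08-24T14:31:19Z (reconciler: no traction for 6.8 d (last activity item-evidence-added at 2026-08-17T17:59:48Z); parked, not closed — `ledger route dormant route-SmoothPoincare4-VerlindeRLinks --off` to reactivate) — unstaffed, not closed; items shared with open routes are served there. `ledger route dormant <id> --off` reactivates.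

# Route VerlindeRLinks — a characteristic-p Temperley–Lieb skein certificate that an R-link resists
sliding refutes SPC4

NEGATIVE-SIDE route (refutation form of the deciding theorem; lens = negation). It suffices to show
X = SLIDE GAP ∧ SLICE RIGIDITY.
SLIDE GAP (crux VrlSlideGap): some R-link L ⊂ S³ (n components, integral surgery ≅ #ⁿ(S²×S¹)) is not
strictly handle-slide equivalent to a
0-framed unlink — the printed Generalised Property R conjecture fails. SLICE RIGIDITY (crux
VrlSliceRigidity): an R-link all of whose
components are smoothly slice IS strictly handle-slide equivalent to a 0-framed unlink. Then
¬SmoothPoincare4: the gap link L has a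
component K that is not slice in B⁴, yet K bounds the core of its 2-handle in the homotopy ball Σ_L
∖ (0-handle) (item
VrlComponentsHBallSlice, rank 9), and a knot slice in a homotopy ball but not in B⁴ gives an exotic
4-sphere (FGMW lemma, the PROVED tree
theorem `Knot.exists_exotic_of_isHomotopyBallSlice_not_isSmoothlySlice_holds`, invoked inside
`closes`). The ENGINE that is to produce the gap (and to test the rigidity) is new:
Décoppet–Haïoun's height-2 mixed Verlinde /
Temperley–Lieb skein functor in characteristic p > 3 (arXiv:2512.14849), read on the closed-off
cobordism S³ → ∅ of a 1-handle-free
homotopy sphere (informal cruxes VrlSkeinCertificate, VrlSkeinBlindOnSphere filed after open;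
definition request D1). No card is realised.
Lean: `(∃ (n : ℕ) (L : Literature.Topology.FourManifolds.FramedLink (Fin n)) (Y : Type) (_ :
TopologicalSpace Y) (_ : T2Space Y) (_ : SecondCountableTopology Y) (_ : ChartedSpace
(EuclideanSpace ℝ (Fin 3)) Y) (_ : IsManifold (𝓡 3) ((⊤ : ℕ∞) : WithTop ℕ∞) Y) (_ : CompactSpace Y)
(_ : ConnectedSpace Y), Literature.Topology.FourManifolds.IsSphereTwoProdCircleSum n Y ∧ L.IsSurgery
(𝓡 3) Y ∧ ∀ U : Literature.Topology.FourManifolds.FramedLink (Fin n), U.IsZeroFramedUnlink → ¬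
Literature.Topology.FourManifolds.IsStrictHandleSlideEquivalent ⟨n, L⟩ ⟨n, U⟩) ∧ (∀ (n : ℕ) (L :
Literature.Topology.FourManifolds.FramedLink (Fin n)) (Y : Type) [TopologicalSpace Y] [T2Space Y]
[SecondCountableTopology Y] [ChartedSpace (EuclideanSpace ℝ (Fin 3)) Y] [IsManifold (𝓡 3) ((⊤ : ℕ∞)
: WithTop ℕ∞) Y] [CompactSpace Y] [ConnectedSpace Y],
Literature.Topology.FourManifolds.IsSphereTwoProdCircleSum n Y → L.IsSurgery (𝓡 3) Y → (∀ i : Fin n,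
(L.component i).IsSmoothlySlice) → ∃ U : Literature.Topology.FourManifolds.FramedLink (Fin n),
U.IsZeroFramedUnlink ∧ Literature.Topology.FourManifolds.IsStrictHandleSlideEquivalent ⟨n, L⟩ ⟨n,
U⟩)`

## Assembly
Pure logic over the three items VrlSlideGap, VrlSliceRigidity, VrlComponentsHBallSlice (glue.lean
`closes`, certified natively, `--refutation`;
rev 3: the FGMW step is discharged INSIDE the proof by the tree theorem; the former item VrlFgmwStep
is dropped and the frame `Assembly` is
restated 3-ary, VrlSlideGap → VrlSliceRigidity → VrlComponentsHBallSlice → ¬SmoothPoincare4): from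
VrlSlideGap take (n, L, Y, instances, R-link data, no-slide clause); if every component of L were
smoothly slice, VrlSliceRigidity would give a 0-framed unlink U strictly slide-equivalent
to L, contradicting the clause; so some component K = L.component i is not smoothly slice (classical
logic), while VrlComponentsHBallSlice
makes K slice in a homotopy ball;
`Knot.exists_exotic_of_isHomotopyBallSlice_not_isSmoothlySlice_holds` turns the pair into a closed
smooth
M ≃ₕ S⁴ with `IsEmpty (M ≃ₘ S⁴)`, and SmoothPoincare4 applied to M gives the contradiction. When σ_p
is defined (D1) the intended glue is
VrlSkeinCertificate → VrlSkeinBlindOnSphere → (R-link sphere is a homotopy sphere) →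
¬SmoothPoincare4 (route edit --closes-file).

Rationale: WHY THIS LINE. Every negative programme on SPC4 needs an invariant not forced to be constant at b₂ =
0; the two in play (Rasmussen-type s, routes
ZeroSurgeryExotic/DottedCircleRasmussen; skein lasagna, closed route GluckLasagna) live on knots and
on closed manifolds. This line points a
THIRD object at the problem, one that exists since December 2025 and has no route: the
Décoppet–Haïoun functor S = S_{Ver_{p(2)}}^{ζ^{1/2}}
on the handle category HD^{2,3,4} (arXiv:2512.14849 Cor. + Thm A/B, built on
Costantino–Geer–Haïoun–Patureau-Mirand arXiv:2306.03225 =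
doi:10.3842/sigma.2026.034): it VANISHES on CP², CP²bar and S²×S² (Thm B) — the first quantum input
passing the stable-dissolution test
(barrier StableBarrierFour; CGHP p. 7) — but by Thm A it has NO 1-handle map, so it is not a
closed-4-manifold invariant at all. The
mechanism of the route is the observation that this defect is harmless exactly on the NEGATIVE side
of SPC4 for geometrically simply
connected spheres: a 1-handle-free homotopy sphere Σ_L (R-link L, n 3-handles) minus its 0-handle is
a morphism S³ → ∅ of HD^{2,3,4}
(2-handles along L, cutting morphisms along the 3-handle spheres, modified trace), so σ_p(L) :=
S(Σ_L ∖ 0h)(Γ₀) ∈ k is defined and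
invariant under precisely the Generalised-Property-R moves (strict 2-handle slides, isotopy, distant
0-framed unknot + cancelling
3-handle) — a finite Temperley–Lieb state sum in characteristic p. One value σ_p(L) ≠ σ_p(∅) is a
CERTIFICATE that L resists sliding
(crux VrlSlideGap = ¬ printed GPRC, Gompf–Scharlemann–Thompson arXiv:1103.1601 Conj. 1, which GST
deem "probably false" but for which
"there is presently no way to distinguish Andrews-Curtis equivalence classes from each other", §7):
the skein functor is such a way, at link
level rather than π₁ level. The bridge from "L resists sliding" to "Σ_L is exotic" is where SPC4
lives (GST Prop. 9.2); it is typed here by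
the surrogate VrlSliceRigidity (slice components ⇒ slides exist; refutable by the same engine on
GST's L_{n,1}, whose spheres are S⁴ by
Gompf 1991) and carried, as intended, by the informal crux VrlSkeinBlindOnSphere (σ_p is constant on
R-link presentations of S⁴ =
Décoppet–Haïoun's Question E restricted to closed-off R-link cobordisms), which implies no
Andrews–Curtis statement. Imported areas: non-
semisimple quantum topology in positive characteristic (tilting modules / mixed higher Verlinde
categories, STWZ 2023, Décoppet 2024),
handle calculus of R-links (GST 2010, Meier–Zupan arXiv:1904.08527), and the tree's FGMW/H-slice
machinery (route ZeroSurgeryExotic's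
proved lemmas). What it does that prior lines do not: ZeroSurgeryExotic/DottedCircleRasmussen
certify a KNOT non-slice by s; GluckLasagna /
card lasagna-three-handles-transparent need the lasagna module of the CLOSED sphere (Gluck-blind,
RSWWZ 2025); card quadric-killers-nogo
(closed known) asked for a theory with Z(S²×S²) = 0 but had none and no assembly; NoOneHandles' crux
C2 (stmt-0377, gsc spheres standard)
had "no invariant known to detect this at b₂ = 0" as its cheapest-falsifier note — this route
supplies the candidate detector and the typed
assembly to ¬SPC4, and its first computation decides something either way (see Cheapest falsifier).

RANKED CRUXES. #2 VrlSlideGap (crux) — SLIDE GAP — there are n, an n-component framed link L ⊂ S³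
and a closed 3-manifold Y ≅ #ⁿ(S²×S¹) with Y = integral surgery on L (an R-link), such that L is not
strictly handle-slide equivalent (GST's 2-handle slides, isotopies, renumbering, reversal) to any
0-framed split unlink; i.e. the printed Generalised Property R conjecture
(`Literature.Topology.FourManifolds.StrictGeneralizedPropertyRConjecture`) is false. Intended proof:
a certificate σ_p(L) ≠ σ_p(∅) from the Décoppet–Haïoun skein functor (informal crux
VrlSkeinCertificate), whose HD^{2,3,4}-functoriality (CGHP Thm; DH Cor.) makes σ_p a strict-slide
invariant. [difficulty: open-problem] (why it might fail: GPRC may be TRUE (n=1 Gabai; Meier–Zupan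
slide-trivialise whole generalized-square-knot families); and even if false, σ_p may be blind to it
(S(S³) tiny, or the closed-off value factors through π₁/AC data and AC(AK(n)) resists
certification).) [GompfScharlemannThompson2010, arXiv:1103.1601, arXiv:1904.08527, arXiv:2512.14849,
arXiv:2306.03225, Kirby1997]
#3 VrlSliceRigidity (crux) — SLICE RIGIDITY (typed surrogate of the bridge) — for every R-link L (as
above) all of whose components are smoothly slice in B⁴, L is strictly handle-slide equivalent to a
0-framed split unlink. Under SPC4 the hypothesis is automatic (components of R-links are slice in
the homotopy ball Σ_L ∖ 0h, and H-ball-slice = slice), so SPC4 ∧ SliceRigidity ⇒ printed GPRC,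
contradicting VrlSlideGap. Honest status: via GST §7 and Gompf 1991 (Σ_{L_{n,1}} ≅ S⁴, so L_{n,1}
has slice components) SliceRigidity implies Andrews–Curtis triviality of every Akbulut–Kirby
presentation AK(n) (tree: `AKPresentationsACNontrivial → ¬ StrictPropertyTwoRConjecture`); it is the
bet that the Andrews–Curtis obstruction never materialises for links with slice components. The
INTENDED bridge, implying no AC statement, is the informal crux VrlSkeinBlindOnSphere (σ_p constant
on R-link presentations of S⁴), which replaces this item in `closes` once σ_p is defined (D1).
[difficulty: open-problem] (why it might fail: GST Conj. 3: L_{n,1} = Q_{3,2} ∪ V_n (sphere S⁴ by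
Gompf/Meier–Zupan, so both components slice) is slide-nontrivial once AK(n) is Andrews–Curtis
nontrivial (n ≥ 3, 'deemed likely'); one certified σ_p(L_{3,1}) ≠ 1 refutes it outright.)
[GompfScharlemannThompson2010, arXiv:1103.1601, arXiv:1904.08527, FreedmanGompfMorrisonWalker2010,
GabaiJDG1987]
#9 VrlComponentsHBallSlice (crux, rank 9: kinded crux so that `closes` is crux-only; a formalisation
obligation rather than a mathematical bet) — every component K_i of an R-link L is slice in a
homotopy 4-ball: the closed manifold Σ_L = B⁴ ∪_L (2-handles) ∪ n(3-handles) ∪ 4-handle (3-handles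
attach since ∂X_L ≅ #ⁿ S¹×S², Laudenbach–Poénaru `exists_diffeomorph_comp_incl_eq`) is simply
connected with χ = 2, H₂ = 0, hence ≃ S⁴, and K_i bounds the core disc of its 2-handle in Σ_L ∖
(open 0-handle) — an `IsSliceDiscIn` datum with e the 0-handle chart. Needs the (deferred,
`DehnSurgery.lean`) compact trace of a framed link; otherwise routine. [difficulty: L]
[GompfScharlemannThompson2010, Kirby1989, ManolescuPiccirillo2023]
(FGMW step — NOT an item since rev 3: 'H-ball-slice ∧ ¬slice ⇒ ¬SmoothPoincare4' is the tree theorem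
`Literature.Topology.FourManifolds.Knot.exists_exotic_of_isHomotopyBallSlice_not_isSmoothlySlice_holds`
plus three lines unfolding the Statement (`HomotopyEquiv.NonemptyDiffeomorphSphere M 4`), exactly as
in `zeroSurgeryExotic_assembly3_proof`; it is invoked inside `closes`. The former support item
VrlFgmwStep was dropped and the frame item Assembly restated 3-ary.)
[FreedmanGompfMorrisonWalker2010, ManolescuPiccirillo2023]

TWO-LAYER PLAN. VrlSlideGap ⇐ (VrlSkeinCertificate: an explicit R-link L₀ — first candidates:
Meier–Zupan's even-n generalized-square-knot R-link families
beyond the slide-trivialised range, GST's L_{n,1} for n ≥ 3, R-links read off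
Akbulut–Kirby/Miller–Schupp balanced presentations — with a
certified value σ_p(L₀) ≠ σ_p(∅) for one prime p > 3, p ≡ 1 mod 4 so that ζ = √−1 ∈ 𝔽_p) →
(VrlSkeinFunctorial: σ_p is invariant under
strict handle slides, isotopy, renumbering/reversal and distant-unknot stabilisation — CGHP Thm 'S_B
: HD^{2,3,4}_4 → Vec is symmetric
monoidal' + DH Cor., relations (1)–(5) of DH Def. 1.1) → VrlSlideGap (k = 2, depth 1).
VrlSliceRigidity is not split; it is superseded by
VrlSkeinBlindOnSphere (σ_p(L) = σ_p(∅) whenever Σ_L ≅ S⁴) once D1 lands.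

KILL CRITERIA. - VrlSliceRigidity REFUTED by a certificate on a link with STANDARD sphere
(σ_p(L_{n,1}) ≠ σ_p(∅), or any proof that some R-link with
  slice components resists sliding): the typed glue is dead; the route survives only if
VrlSkeinBlindOnSphere can be typed (D1 landed) and
  re-glued within the repair window — else close `refuted:VrlSliceRigidity` and re-file the engine
as a card (by-product kept: ¬GPRC).
- VrlSlideGap REFUTED (printed GPRC proved) ⇒ close `refuted:VrlSlideGap` (the whole 1-handle-free
negative programme dies with it; GST
  Prop. 9.2 then gives SPC4 for gsc spheres to route NoOneHandles).
- A theorem 'σ_p(L) depends only on (S³_0(L), n)' or 'S_{Ver_p(2)}(S³ → ∅) is constant on closed-off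
R-link cobordisms' (blindness) ⇒ the
  engine is dead: pivot to another chromatic-degenerate input (Conj. D of DH: heights n ≥ 3;
Faes–Manko arXiv:2503.19532 non-factorizable
  Hopf algebras) by a dated note, or close exhausted.
- A proof that S_{Ver_p(2)} extends to 1-handles after all on the relevant subcategory AND is
Reutter-type (factoring through stable
  diffeomorphism) ⇒ blind on all homotopy spheres ⇒ close.
- MOOT if SPC4 is refuted elsewhere; VrlComponentsHBallSlice stays a valid lemma.

NOT DECOMPOSED YET. - The choice of L₀ and of p, the explicit complete sphere system in S³_0(L₀)
needed for the cutting morphisms (a search: planar surfaces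
  in S³ ∖ νL₀ capped by surgery discs; automatic for links slide-trivialised in print, by hand for
GST/MZ families via the fibred-knot
  structure), and the implementation of the height-2 Temperley–Lieb calculus at ζ = 4th root of
unity in characteristic p (DH §§2–3:
  idempotents E_{v−1}, fusion with the generator, twists, encirclements, Hopf pairings, modified
trace, cutting and chromatic morphisms)
  — all below crux level, inside VrlSkeinCertificate; batched into ONE kit job when run.
- Whether HD^{2,3,4}-equivalence of (L ∪ caps) is strictly coarser than stable strict
slide-equivalence (2/3 cancellations against an
  explicit dual sphere): irrelevant for the typed glue, recorded for VrlSkeinFunctorial.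
- The stable (distant-unknot) refinement of both typed cruxes (`FramedLink` disjoint union with a
split unknot is not in the tree).
- The compact trace / closed manifold Σ_L of a framed link as a Lean object (deferred in
`DehnSurgery.lean`): needed only inside the proofs of
  VrlComponentsHBallSlice and of the future typed VrlSkeinBlindOnSphere — definition request D0
below, not an item.

CHEAPEST FALSIFIER. For the MECHANISM and BOTH bridges at once: by Meier–Zupan Thm 1.1/1.2
(arXiv:1904.08527) every 2R-link containing a generalized
square knot Q_{p,q} has sphere S⁴ but is trivialised only through ≤ 2 Hopf pairs (1-handles, where S
has no map), its stable slide
status being open; GST's L_{n,1} = Q_{3,2} ∪ V_n (n ≥ 3) are the AC-suspicious members. ONE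
computation, σ_5(L_{3,1}): if ≠ 1 = σ_5(∅),
VrlSliceRigidity and the intended bridge VrlSkeinBlindOnSphere die together (two presentations of
S⁴, different σ), the route closes
refuted — by-product: the (stable) Generalised Property R conjecture is FALSE, a theorem worth the
route; if σ_p = 1 on L_{1,1}, L_{2,1}
(calibration: slide-trivial in print), L_{3,1}, L_{4,1}, the engine is calibrated-or-blind and the
next target is an R-link whose
sphere is NOT known standard (Meier–Zupan even-n ≥ 4 families). Not runnable by kit today (no
implementation of the char-p height-2 TL
calculus: definition request D1; plan in VrlComputePlan.md); lookup run: DH (Dec 2025) / CGHP (SIGMA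
2026) evaluate only CP², CP²bar,
S²×S², Mazur; DH Question E is open.

NUMBERS. - DH Thm B: for every prime p > 3 and ζ a primitive 4th root of unity, Ṡ(CP²) = Ṡ(CP²bar) =
Ṡ(S²×S²) = 0; p = 3: Ver_{3(2)} non-degenerate
  ⇒ invertible TQFT, useless; height 1: separable ⇒ Reutter-blind. DH Thm A: no extension of
S_{Ver_{p(2)}} from HD^{2,3,4} to HD^{1,2,3,4}.
- GST: L_{n,k} R-links with surgery #²(S¹×S²); AC-trivial (hence conclusion of GPR holds) for n = 0,
1, k = 0, (n,k) = (2,1) (§8); L_{n,1},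
  n ≥ 3, tied to AK(n). Meier–Zupan: every gsc homotopy sphere with two 2-handles one of which is a
generalized square knot Q_{p,q} is S⁴;
  'large families, for all even n, of nR-links that are potential counterexamples to GPRC'.
- Items: 4 typed at open (2 cruxes, 2 supports); since rev 3 three typed items (VrlSlideGap r2,
VrlSliceRigidity r3, VrlComponentsHBallSlice r9),
  all hypotheses of `closes`, + the restated 3-ary Assembly frame + 3 informal statements filed
after open (VrlSkeinCertificate r4 =
  stmt-SmoothPoincare4-16079, VrlSkeinBlindOnSphere r5 = stmt-16083, VrlSkeinFunctorial r9 =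
stmt-16096) + 2 definition requests (D0, D1)
  + cite facts — ≤ 15.
- Import cone of the route file: PropertyRStrict (Kirby-move vocabulary; the smoothness-fact
instances are the PROVED ones of
  KnotsProofs / LinkingNumberPushOffInstance), HomotopyBallSlice, and (rev 3)
HomotopyBallSliceProofs for the FGMW `_holds` theorem used
  inside `closes`; native preview 2026-08-16: dependency cone 71 project constants, 0 unproved (the
only binder-free Prop without `_holds`
  is the Statement's definiens `Literature.SPC4.SmoothPoincareConjectureFour`).

DEFINITION REQUESTS. - D1 `mixedVerlindeRLinkInvariant` (topic Literature/QuantumTopology): for a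
prime p > 3 with p ≡ 1 mod 4, the height-2 mixed Verlinde
  category Ver_{p(2)}^{ζ^{1/2}} as EXPLICIT FINITE DATA (indecomposables of J_{p(1)}/J_{p(2)},
fusion rules with the generator, braiding,
  twists, modified trace — DH §2, arXiv:2512.14849) and the evaluation σ_p of a (framed link
diagram, complete sphere system) pair by DH §3
  (chromatic morphism per 2-handle relative to Γ₀, cutting morphism per 3-handle, modified trace),
valued in 𝔽_p (or `GaloisField p 2`);
  plus the statement-level NAMED FACTS `cghp_functor_HD234` (CGHP Thm: S_B is a symmetric monoidal
functor on HD^{2,3,4}_4 for unimodular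
  finite ribbon B with m-trace) and `dh_thmB_vanishing` (cite items).
- D0 `FramedLink.closedTraceSphere` / `IsRLinkSphere X L` (topic Literature/Topology/FourManifolds):
X is a closed smooth 4-manifold with a
  handle decomposition 0h ∪ (2-handles along L) ∪ n(3h) ∪ 4h — the compact trace of a framed link,
deferred in `DehnSurgery.lean`; needed to
  TYPE VrlSkeinBlindOnSphere ('Nonempty (X ≃ₘ S⁴) → σ_p L = σ_p ∅') and to PROVE
VrlComponentsHBallSlice.
- Informal statements to be filed right after open (workitem add --informal): VrlSkeinCertificate
(rank 4, crux, computational),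
  VrlSkeinBlindOnSphere (rank 5, crux), VrlSkeinFunctorial (rank 9, support/cite).

Novelty: Searches (2026-08-16): `lit search "Temperley-Lieb positive characteristic 2-handlebody invariant"
--source arxiv` (1 hit: arXiv:2512.14849 itself); `lit search "Kerler-Lyubashenko functors
4-dimensional 2-handlebodies"` (1: arXiv:2105.02789); `lit search "generalized square knots homotopy
4-spheres Meier Zupan"` (1: arXiv:1904.08527); `lit search "Property R handle slides Andrews-Curtis
Gompf Scharlemann Thompson" --source arxiv` (0); `lit galaxy search "invariants of 4-dimensional
2-handlebodies non-semisimple" --star all` (0); `lit galaxy search "Property 2R" --star all` (2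
irrelevant pdf hits); local searchd unavailable all session (ConnectionReset ×6); `lit read` of
arXiv:2601.05425 pp. 5–7, 21–25 (Manolescu 2026 survey: negative programmes = s/0-friends, lasagna
Q6.5), arXiv:2306.03225 pp. 1–8, 40–45 (CGHP: 'chromatic compact cannot detect exotic pairs', p. 7),
arXiv:2512.14849 pp. 1–12 (DH Thm A/B, Def. 1.1, Question 1.4, Def. 1.11, Question E),
arXiv:2105.02789 abstract, arXiv:1904.08527 abstract; tree:
Theses/{ZeroSurgeryExotic,DottedCircleRasmussen,GluckLasagna,NoOneHandles}.lean,
Barriers/{StableInvariantsBlind*,PropertyTwoRAndrewsCurtis,GluckTwistsDissolve}.lean, 25 idea cards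
incl. quadric-killers-nogo (closed known), lasagna-three-handles-transparent, cork-twins-census,
decidability-wedge-rabin-q2, kesten-genericity-kirby-diagrams.
Nearest prior art found: arXiv:2512.14849 (Décoppet–Haïoun, Dec 2025: the functor, Thm B vanishing,
Question E 'are Ṡ diffeomorphism  [refs: 2512.14849, 2105.02789, 1904.08527, 2601.05425, 2306.03225, 1103.1601]

Barriers (technique_class: nonsemisimple-skein, r-link-slides, fgmw-hslice): - technique_class: nonsemisimple-skein, r-link-slides, fgmw-hslice
- Literature.Barriers.SmoothPoincare4.StableBarrierFour: evaded by construction — the engine is not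
an S²×S²-stable invariant: Ṡ(S²×S²°) = 0 is a zero-divisor (DH Thm B), so Wall/Θ₄ dissolution forces
nothing (zero-divisor lemma of card quadric-killers-nogo); Reutter's semisimplicity hypothesis fails
(Ver_{p(2)} has non-separable Müger centre, DH/Déc24).
- Literature.Barriers.SmoothPoincare4.GluckTwistCP2Barrier: evaded in the same algebraic sense
(Ṡ(CP²°) = Ṡ(CP²bar°) = 0), but conceded by mechanism on the Gluck family itself: a Gluck twist need
not be 1-handle-free, and the vacuum-twist lemma (NOTES Barrier notes) suggests RT-type theories are
Gluck-blind; candidates are R-links, not Gluck twists.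
- Literature.Barriers.SmoothPoincare4.StrictPropertyTwoRBarrier: ENGAGED HEAD-ON, not evaded —
VrlSlideGap is the negation of printed GPRC (the barrier's conclusion under
AKPresentationsACNontrivial), and VrlSliceRigidity implies ¬AKPresentationsACNontrivial; the bet of
the typed glue is that links with slice components carry no Andrews–Curtis obstruction; the intended
bridge VrlSkeinBlindOnSphere makes no AC claim.
- Literature.Barriers.SmoothPoincare4.GaugeSumBarrierFour, .HCobordismInvariantBarrierFour,
.TopologicalBarrierFour: not applicable — σ_p is neither a gauge count, nor an h-cobordism or
homeomorphism invariant (it is not even a diffeomorphism invariant a priori: DH Thm A), and it is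
read on the link, no

History (route lifecycle, newest last):
- 2026-08-16T17:49:52Z · rev 3: restated Assembly (stmt-SmoothPoincare4-15876) — route-repair (glue): closes is now crux-only with 3 hypotheses (VrlSlideGap, VrlSliceRigidity, VrlComponentsHBallSlice); the FGMW step is discharged inside the (planner-rbadge-SmoothPoincare4-VerlindeRLinks-12f02b27-0)
- 2026-08-16T17:49:52Z · rev 3: dropped VrlFgmwStep — route-repair (glue): closes is now crux-only with 3 hypotheses (VrlSlideGap, VrlSliceRigidity, VrlComponentsHBallSlice); the FGMW step is discharged inside the (planner-rbadge-SmoothPoincare4-VerlindeRLinks-12f02b27-0)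
- 2026-08-16T17:57:28Z · rev 5: restated VrlSlideGap (stmt-SmoothPoincare4-15872), VrlSliceRigidity (stmt-SmoothPoincare4-15873) — cone repair (route-repair planner, cone): drop imports KnotsProofs (redundant — already in PropertyRStrict's closure) and LinkingNumberPushOffInstance (its clos (planner-rrepair-SmoothPoincare4-VerlindeRLinks-12f02b27-0)
- 2026-08-24T14:31:19Z · DORMANT — reconciler: no traction for 6.8 d (last activity item-evidence-added at 2026-08-17T17:59:48Z); parked, not closed — `ledger route dormant route-SmoothPoincare4- (operator:999:1090373)

sub-problem: SmoothPoincare4 · status: dormant · opened planner-plan-lens-SmoothPoincare4-negation-v2-g2-0 2026-08-16T17:34:41Z · rev 6 · ledger route-SmoothPoincare4-VerlindeRLinks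
GENERATED by the gate from the ledger (D-0016/17). Provers cite these decls: `theorem foo : Summit.SmoothPoincare4.SmoothPoincare4.Theses.VerlindeRLinks.<Decl> := …` in Summits/SmoothPoincare4/SmoothPoincare4/Theorems/<Name>.lean.
-/

namespace Summit.SmoothPoincare4.SmoothPoincare4.Theses.VerlindeRLinks

open scoped BigOperators Topology Manifold Classical MeasureTheory ProbabilityTheory Matrix InnerProductSpace ComplexConjugate ContinuousMap
open Filter Set Function TopologicalSpace MeasureTheory

attribute [summit_statement] _root_.SmoothPoincare4

open Literature.SPC4

-- earlier VrlSlideGap (stmt-SmoothPoincare4-15872, replaced 2026-08-16T17:57:28Z -> stmt-SmoothPoincare4-16178): retired by None — ∃ (n : ℕ) (L : Literature.Topology.FourManifolds.FramedLink (Fin n)) (Y : Type) (_ : TopologicalSpace Y) (_ : T2Space Y) (_ : SecondCountableTopology Y) (_ : ChartedSpace (EuclideanSpace ℝ (Fin 3)) Y) (_ : IsManifold (𝓡 3) ((⊤ : ℕ∞) : WithTop ℕ∞) Y) (_ : CompactSpace Y) 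
/-- item stmt-SmoothPoincare4-16178 · crux · rank 2 · open · by planner
why it might fail: GPRC may be TRUE (n=1 Gabai; Meier–Zupan slide-trivialise whole generalized-square-knot families); and even if false, σ_p may be blind to it (S(S³) tiny, or the closed-off value factors through π₁/AC data and AC(AK(n)) resists certification).
sources: GompfScharlemannThompson2010, arXiv:1103.1601, arXiv:1904.08527, arXiv:2512.14849, arXiv:2306.03225, Kirby1997
[crux] SLIDE GAP — there are n, an n-component framed link L ⊂ S³ and a closed 3-manifold Y ≅
#ⁿ(S²×S¹) with Y = integral surgery on L (an R-link), such that L is not strictly handle-slide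
equivalent (GST's 2-handle slides, isotopies, renumbering, reversal) to any 0-framed split unlink;
i.e. the printed Generalised Property R conjecture
(`Literature.Topology.FourManifolds.StrictGeneralizedPropertyRConjecture`) is false. Intended proof:
a certificate σ_p(L) ≠ σ_p(∅) from the Décoppet–Haïoun skein functor (informal crux
VrlSkeinCertificate), whose HD^{2,3,4}-functoriality (CGHP Thm; DH Cor.) makes σ_p a strict-slide
invariant. [difficulty: open-problem] TYPING (cone repair 2026-08-16): the Prop-class
`Knot.TubularNbhd.SmoothnessFacts` (push-offs are smooth embeddings; PROVED in the tree,
`Knot.TubularNbhd.isSmoothEmbedding_pushOff_holds`) is carried as a leading `∃ (_ :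
…SmoothnessFacts)` conjunct instead of the global instance of `LinkingNumberPushOffInstance`, so the
route file no longer imports that module (whose closure vendors the unproved Alexander-polynomial /
Gluck-twist facts); the statement is equivalent to the previous one (a prover supplies
`⟨inferInstance, …⟩` after impo -/
@[route_item "route-SmoothPoincare4-VerlindeRLinks", crux]
def VrlSlideGap : Prop :=
  ∃ (_ : Literature.Topology.FourManifolds.Knot.TubularNbhd.SmoothnessFacts) (n : ℕ) (L : Literature.Topology.FourManifolds.FramedLink (Fin n)) (Y : Type) (_ : TopologicalSpace Y) (_ : T2Space Y) (_ : SecondCountableTopology Y) (_ : ChartedSpace (EuclideanSpace ℝ (Fin 3)) Y) (_ : IsManifold (𝓡 3) ((⊤ : ℕ∞) : WithTop ℕ∞) Y) (_ : CompactSpace Y) (_ : ConnectedSpace Y), Literature.Topology.FourManifolds.IsSphereTwoProdCircleSum n Y ∧ L.IsSurgery (𝓡 3) Y ∧ ∀ U : Literature.Topology.FourManifolds.FramedLink (Fin n), U.IsZeroFramedUnlink → ¬ Literature.Topology.FourManifolds.IsStrictHandleSlideEquivalent ⟨n, L⟩ ⟨n, U⟩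

-- earlier VrlSliceRigidity (stmt-SmoothPoincare4-15873, replaced 2026-08-16T17:57:28Z -> stmt-SmoothPoincare4-16179): retired by None — ∀ (n : ℕ) (L : Literature.Topology.FourManifolds.FramedLink (Fin n)) (Y : Type) [TopologicalSpace Y] [T2Space Y] [SecondCountableTopology Y] [ChartedSpace (EuclideanSpace ℝ (Fin 3)) Y] [IsManifold (𝓡 3) ((⊤ : ℕ∞) : WithTop ℕ∞) Y] [CompactSpace Y] [ConnectedSpace Y],
/-- item stmt-SmoothPoincare4-16179 · crux · rank 3 · open · by planner
why it might fail: GST Conj. 3: L_{n,1} = Q_{3,2} ∪ V_n (sphere S⁴ by Gompf/Meier–Zupan, so both components slice) is slide-nontrivial once AK(n) is Andrews–Curtis nontrivial (n ≥ 3, 'deemed likely'); one certified σ_p(L_{3,1}) ≠ 1 refutes it outright.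
sources: GompfScharlemannThompson2010, arXiv:1103.1601, arXiv:1904.08527, FreedmanGompfMorrisonWalker2010, GabaiJDG1987
[crux] SLICE RIGIDITY (typed surrogate of the bridge) — for every R-link L (as above) all of whose
components are smoothly slice in B⁴, L is strictly handle-slide equivalent to a 0-framed split
unlink. Under SPC4 the hypothesis is automatic (components of R-links are slice in the homotopy ball
Σ_L ∖ 0h, and H-ball-slice = slice), so SPC4 ∧ SliceRigidity ⇒ printed GPRC, contradicting
VrlSlideGap. Honest status: via GST §7 and Gompf 1991 (Σ_{L_{n,1}} ≅ S⁴, so L_{n,1} has slice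
components) SliceRigidity implies Andrews–Curtis triviality of every Akbulut–Kirby presentation
AK(n) (tree: `AKPresentationsACNontrivial → ¬ StrictPropertyTwoRConjecture`); it is the bet that the
Andrews–Curtis obstruction never materialises for links with slice components. The INTENDED bridge,
implying no AC statement, is the informal crux VrlSkeinBlindOnSphere (σ_p constant on R-link
presentations of S⁴), which replaces this item in `closes` once σ_p is defined (D1). [difficulty:
open-problem] TYPING (cone repair 2026-08-16): stated under the instance binder `∀
[Knot.TubularNbhd.SmoothnessFacts]` (a Prop-class PROVED in the tree,
`Knot.TubularNbhd.isSmoothEmbedding_pushOff_holds`) instead of the global insta -/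
@[route_item "route-SmoothPoincare4-VerlindeRLinks", crux]
def VrlSliceRigidity : Prop :=
  ∀ [Literature.Topology.FourManifolds.Knot.TubularNbhd.SmoothnessFacts] (n : ℕ) (L : Literature.Topology.FourManifolds.FramedLink (Fin n)) (Y : Type) [TopologicalSpace Y] [T2Space Y] [SecondCountableTopology Y] [ChartedSpace (EuclideanSpace ℝ (Fin 3)) Y] [IsManifold (𝓡 3) ((⊤ : ℕ∞) : WithTop ℕ∞) Y] [CompactSpace Y] [ConnectedSpace Y], Literature.Topology.FourManifolds.IsSphereTwoProdCircleSum n Y → L.IsSurgery (𝓡 3) Y → (∀ i : Fin n, (L.component i).IsSmoothlySlice) → ∃ U : Literature.Topology.FourManifolds.FramedLink (Fin n), U.IsZeroFramedUnlink ∧ Literature.Topology.FourManifolds.IsStrictHandleSlideEquivalent ⟨n, L⟩ ⟨n, U⟩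

/-- item stmt-SmoothPoincare4-15874 · crux · rank 9 · closed · proved by Summit.SmoothPoincare4.SmoothPoincare4.Theorems.VrlComponentsHBallSlice.KirbyLemma21.VrlComponentsHBallSlice_proof @ 8db2a0c0bb74 (prover) · by planner
why it might fail: True on paper (2-handle cores in Σ_L ∖ 0h); can fail only as TYPED: `IsSliceDiscIn` conventions (boundary = e∘K on the unit sphere of the 0-handle chart, open disc off the closed ball) must match the trace's attaching data for `L.component i`; a convention mismatch forces a restatement.
sources: GompfScharlemannThompson2010, Kirby1989, ManolescuPiccirillo2023, FreedmanGompfMorrisonWalker2010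
[support] every component K_i of an R-link L is slice in a homotopy 4-ball: the closed manifold Σ_L
= B⁴ ∪_L (2-handles) ∪ n(3-handles) ∪ 4-handle (3-handles attach since ∂X_L ≅ #ⁿ S¹×S²,
Laudenbach–Poénaru `exists_diffeomorph_comp_incl_eq`) is simply connected with χ = 2, H₂ = 0, hence
≃ S⁴, and K_i bounds the core disc of its 2-handle in Σ_L ∖ (open 0-handle) — an `IsSliceDiscIn`
datum with e the 0-handle chart. Needs the (deferred, `DehnSurgery.lean`) compact trace of a framed
link; otherwise routine. [difficulty: L] -/
@[route_item "route-SmoothPoincare4-VerlindeRLinks", crux]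
def VrlComponentsHBallSlice : Prop :=
  ∀ (n : ℕ) (L : Literature.Topology.FourManifolds.FramedLink (Fin n)) (Y : Type) [TopologicalSpace Y] [T2Space Y] [SecondCountableTopology Y] [ChartedSpace (EuclideanSpace ℝ (Fin 3)) Y] [IsManifold (𝓡 3) ((⊤ : ℕ∞) : WithTop ℕ∞) Y] [CompactSpace Y] [ConnectedSpace Y], Literature.Topology.FourManifolds.IsSphereTwoProdCircleSum n Y → L.IsSurgery (𝓡 3) Y → ∀ i : Fin n, (L.component i).IsHomotopyBallSlice

-- item stmt-SmoothPoincare4-16079 · support · rank 4 · open · by planner — informal only, no Lean statement yet: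
--   [crux] SKEIN CERTIFICATE (computational; the engine of VrlSlideGap). For some prime p > 3 with p ≡ 1
--   mod 4 (ζ = √−1 ∈ 𝔽_p) and some explicit R-link L₀ ⊂ S³ (n components, S³_0(L₀) ≅ #ⁿ S¹×S², with an
--   explicit complete system of n disjoint non-separating 2-spheres in S³_0(L₀) given as planar surfaces
--   in S³ ∖ νL₀ capped by surgery discs), the Décoppet–Haïoun value σ_p(L₀) :=
--   S_{Ver_{p(2)}^{ζ^{1/2}}}(Σ_{L₀} ∖ 0-handle : S³ → ∅)(Γ₀) — chromatic 2-handle maps along L₀ relative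
--   to the skein Γ₀ (closed T_ζ(1)-circle in a small ball, DH Ex. 3.3), cutting morphisms along the n
--   spheres (DH Lemma 3.2), m

-- item stmt-SmoothPoincare4-16083 · support · rank 5 · open · by planner — informal only, no Lean statement yet:
--   [crux] SKEIN BLINDNESS ON THE STANDARD SPHERE (the INTENDED bridge; supersedes VrlSliceRigidity in
--   `closes` once D0/D1 land). For every prime p > 3 (p ≡ 1 mod 4) and every R-link L whose closed
--   1-handle-free 4-manifold Σ_L (0-handle ∪ 2-handles along L ∪ n 3-handles ∪ 4-handle) is
--   diffeomorphic to S⁴, σ_p(L) = σ_p(∅) = 1 — i.e. the closed-off Décoppet–Haïoun value is an invariant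
--   of the diffeomorphism type on R-link presentations of S⁴ (Décoppet–Haïoun Question E restricted to
--   closed-off R-link cobordisms S³ → ∅). With VrlSkeinCertificate: σ_p(L₀) ≠ 1 ⇒ Σ_{L₀} ≇ S⁴ while
--   Σ_{L₀} ≃ S⁴ (simply co

-- item stmt-SmoothPoincare4-16096 · support · rank 9 · open · by planner — informal only, no Lean statement yet:
--   [support / cite] SKEIN FUNCTORIALITY. The closed-off value σ_p(L) := S_{Ver_{p(2)}^{ζ^{1/2}}}(Σ_L ∖
--   0-handle : S³ → ∅)(Γ₀) of an R-link L is well defined (independent of the complete sphere system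
--   chosen for the 3-handles and of the identification S³_0(L) ≅ #ⁿ S¹×S² — every diffeomorphism of #ⁿ
--   S¹×S² extends over ♮ⁿ S¹×B³ (Laudenbach) and any two complete non-separating sphere systems are
--   related by slides and isotopy) and invariant under strict 2-handle slides, isotopy, renumbering and
--   reversal of components, adjunction of a distant 0-framed unknot with its cancelling 3-handle, and
--   3-handle s

-- earlier Assembly (stmt-SmoothPoincare4-15876, replaced 2026-08-16T17:49:52Z -> stmt-SmoothPoincare4-16167): retired by None — VrlSlideGap → VrlSliceRigidity → VrlComponentsHBallSlice → VrlFgmwStep → ¬ SmoothPoincare4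
/-- item stmt-SmoothPoincare4-16167 · assembly · rank 1 · open · by planner
sources: GompfScharlemannThompson2010, FreedmanGompfMorrisonWalker2010
[assembly] VrlSlideGap → VrlSliceRigidity → VrlComponentsHBallSlice → ¬SmoothPoincare4 (the frame of
the deciding theorem `closes`, rev 3: the FGMW step is the tree theorem
`Knot.exists_exotic_of_isHomotopyBallSlice_not_isSmoothlySlice_holds` invoked inside the proof; pure
logic). -/
@[route_item "route-SmoothPoincare4-VerlindeRLinks"]
def Assembly : Prop :=
  VrlSlideGap → VrlSliceRigidity → VrlComponentsHBallSlice → ¬ SmoothPoincare4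

/-! D-0027 §2.1 — DECIDING THEOREM (planner-authored via `route open/edit --closes-file`; by planner-rrepair-SmoothPoincare4-VerlindeRLinks-12f02b27-0 2026-08-16T17:57:28Z):
its hypotheses are this route's items and its conclusion the sub-problem Statement (glue_lint), and it elaborates with this file. -/

@[closes "route-SmoothPoincare4-VerlindeRLinks"] theorem closes (h₁ : VrlSlideGap) (h₂ : VrlSliceRigidity) (h₃ : VrlComponentsHBallSlice) :
    ¬ _root_.SmoothPoincare4 := by
  intro hS
  obtain ⟨iν, n, L, Y, i₁, i₂, i₃, i₄, i₅, i₆, i₇, hY, hL, hgap⟩ := h₁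
  have hns : ¬ ∀ i : Fin n, (L.component i).IsSmoothlySlice := by
    intro hall
    obtain ⟨U, hU, hLU⟩ := @h₂ iν n L Y i₁ i₂ i₃ i₄ i₅ i₆ i₇ hY hL hall
    exact hgap U hU hLU
  obtain ⟨i, hi⟩ : ∃ i : Fin n, ¬ (L.component i).IsSmoothlySlice := by
    by_contra hcon
    exact hns fun i => Classical.byContradiction fun hi => hcon ⟨i, hi⟩
  obtain ⟨M, _, _, _, _, _, _, ⟨e⟩, hE⟩ :=
    Literature.Topology.FourManifolds.Knot.exists_exotic_of_isHomotopyBallSlice_not_isSmoothlySlice_holds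
      ⟨L.component i, @h₃ n L Y i₁ i₂ i₃ i₄ i₅ i₆ i₇ hY hL i, hi⟩
  obtain ⟨d⟩ := hS M ‹_› ‹_› e
  exact hE.false d

end Summit.SmoothPoincare4.SmoothPoincare4.Theses.VerlindeRLinks
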